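import Summits.Ventures.Crystal3D.Theorems.StickyWulffConstantCoaxialWallLawSeamSatCensusTwelveOneFreeDegree
import HarnessLib

/-!
# One-free-pair kissing configurations: a five-contact node PINS the exempt pair at squared distance `128/27`
# (crux `CoaxialWallLaw`, stmt-Ventures-19481; lane F stubs `stub_satCensus12Narrow` / `stub_satCensus12Glide` ⇐ C1 = `KissingClassificationOneFree (5/2)`;
#  sequel of '…SeamSatCensusTwelveOneFreeDegree')

HONEST FRAMING. Venture `Summits/Ventures/Crystal3D` (cell `crystal3d-full`); helper `--supports` stmt-Ventures-19481, no stub closed.  '…OneFreeDegree' proved that a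
node of a one-free-pair `5/2`-configuration has `≤ 5` contacts and that five contacts force both exempt points among them.  Here the quantitative completion, by
Hales's tangent-angle method (Lemma 7; the tree's `KissingNodeDegree`): around a node with five contacts the five tangent gaps are each `≥ α = arccos (1/3)` and sum to
`2π`, so each is `≤ 2π − 4α` and has cosine `≥ 17/81`; every non-exempt consecutive pair is therefore a contact (gap `α` exactly), the exempt pair IS a consecutive
pair, and its gap is `2π − 4α` with cosine `cos 4α = 17/81`, i.e. its chord is `√(6 − 6·17/81) = √(128/27) ≈ 2.177`:
* `five_gaps_exempt` — five nonnegative gaps summing to `2π`, all with cosine `≤ 1/3`, all but (possibly) one with cosine `= 1/3` or `≤ σ < 17/81`: the remaining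
  gap has cosine `17/81`;
* `five_neighbours_exempt_dist_sq` — five points of `S²(2)` at distance `2` from `v`, pairwise `≥ 2` apart, all pairs `= 2` or `≥ 5/2` apart except one
  exempt pair: that pair is at squared distance EXACTLY `128/27`;
* **`dist_sq_exempt_eq_of_five_contacts`** — in a one-free-pair `5/2`-configuration with exempt points `a, b`, a node with five contacts forces
  `dist a b ^ 2 = 128/27` (so `dist a b ≈ 2.177`: the D₅ₕ two-ring value of '…TwoFreeRing').
Consequence for a C1 certificate: EITHER every node has `≤ 4` contacts (and the K25 growth-search axiom `cdeg_le` survives verbatim, only `dichot` is relaxed at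
one label pair), OR the exempt Gram entry is pinned (`⟪a, b⟫ = 44/27` on `S²(2)`, `11/27` for unit vectors) — a rigid, tiny side case.
WHAT THIS IS NOT: C1 is NOT proved; no `SatCensus` piece is closed; F-C1 not moved.
-/

noncomputable section

namespace Summit.Ventures.Crystal3D.Theorems

namespace TailResidue

open Summit.Ventures.Crystal3D Finset Real
open Literature.Geometry.DiscreteGeometry (arccos_third_le_of_cos_le pi_div_four_lt_arccos_third cos_four_mul_arccos_third five_gaps_false
  exists_orthonormalBasis_third_eq inner_eq_two_of_dist_eq_two inner_eq_sum_three eq_of_inner_basis_eq eq_sqrt_three_mul_cos_sin_arg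
  mul_add_mul_eq_three_mul_cos)
open scoped RealInnerProductSpace

/-! ### Part A. Five gaps with one exemption -/

/-- **Five gaps, one exempt.**  Five nonnegative angles summing to `2π`, each with cosine `≤ 1/3`, and each — except possibly the gap `e` — with cosine exactly
`1/3` or `≤ σ < 17/81`: then the gap `e` has cosine `17/81` (the others are `α = arccos (1/3)` and `g e = 2π − 4α`). [cite: Hales2012, Lemma 7 (method)] -/
theorem five_gaps_exempt {σ : ℝ} (hσ : σ < 17 / 81) (g : Fin 5 → ℝ) (h0 : ∀ k, 0 ≤ g k)
    (hsum : g 0 + g 1 + g 2 + g 3 + g 4 = 2 * π) (hc : ∀ k, cos (g k) ≤ 1 / 3) (e : Fin 5)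
    (hd : ∀ k, k ≠ e → cos (g k) = 1 / 3 ∨ cos (g k) ≤ σ) : cos (g e) = 17 / 81 := by
  set α := arccos (1 / 3) with hα
  have hlow : ∀ k, α ≤ g k := fun k => arccos_third_le_of_cos_le (h0 k) (hc k)
  have hpi4 : π / 4 < α := pi_div_four_lt_arccos_third
  have hup : ∀ k, g k ≤ 2 * π - 4 * α := by
    intro k
    have h0' := hlow 0; have h1' := hlow 1; have h2' := hlow 2; have h3' := hlow 3
    have h4' := hlow 4
    fin_cases k <;> simp only [Fin.zero_eta, Fin.mk_one, Fin.reduceFinMk] <;> linarith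
  have heq : ∀ k, k ≠ e → g k = α := by
    intro k hk
    have hk1 : g k ≤ π := by linarith [hup k]
    have hcos : 17 / 81 ≤ cos (g k) := by
      rw [← cos_four_mul_arccos_third, ← cos_two_pi_sub]
      exact cos_le_cos_of_nonneg_of_le_pi (h0 k) (by linarith) (hup k)
    have h13 : cos (g k) = 1 / 3 := by
      rcases hd k hk with h | h
      · exact h
      · exact absurd (hcos.trans h) (not_le.2 hσ)
    rw [← arccos_cos (h0 k) hk1, h13]
  have hge : g e = 2 * π - 4 * α := by
    fin_cases e
    · have h1 := heq 1 (by decide); have h2 := heq 2 (by decide); have h3 := heq 3 (by decide); have h4 := heq 4 (by decide)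
      simp only [Fin.zero_eta] at *; linarith
    · have h1 := heq 0 (by decide); have h2 := heq 2 (by decide); have h3 := heq 3 (by decide); have h4 := heq 4 (by decide)
      simp only [Fin.mk_one] at *; linarith
    · have h1 := heq 0 (by decide); have h2 := heq 1 (by decide); have h3 := heq 3 (by decide); have h4 := heq 4 (by decide)
      simp only [Fin.reduceFinMk] at *; linarith
    · have h1 := heq 0 (by decide); have h2 := heq 1 (by decide); have h3 := heq 2 (by decide); have h4 := heq 4 (by decide)
      simp only [Fin.reduceFinMk] at *; linarith
    · have h1 := heq 0 (by decide); have h2 := heq 1 (by decide); have h3 := heq 2 (by decide); have h4 := heq 3 (by decide)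
      simp only [Fin.reduceFinMk] at *; linarith
  rw [hge, cos_two_pi_sub, cos_four_mul_arccos_third]

/-! ### Part B. Five sorted tangent angles with one exempt pair -/

/-- The five cyclic gaps of sorted angles: source and target indices `(1,0), (2,1), (3,2), (4,3), (0,4)` — gap `k` is `t (gapHi k) − t (gapLo k)` for `k < 4` and the
wrap-around `2π − (t 4 − t 0)` for `k = 4`. -/
def gapHi : Fin 5 → Fin 5 := ![1, 2, 3, 4, 4]
/-- See `gapHi`. -/
def gapLo : Fin 5 → Fin 5 := ![0, 1, 2, 3, 0]

/-- Two different cyclic gaps carry different unordered index pairs (finite check). -/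
theorem gap_pair_unique : ∀ p q k₀ k : Fin 5, ((gapHi k₀ = p ∧ gapLo k₀ = q) ∨ (gapHi k₀ = q ∧ gapLo k₀ = p)) →
    ((gapHi k = p ∧ gapLo k = q) ∨ (gapHi k = q ∧ gapLo k = p)) → k = k₀ := by
  decide

/-- **Five sorted directions, one exempt pair.**  Angles `−π < t₀ < ⋯ < t₄ ≤ π`, every difference with cosine `≤ 1/3`, and every pair — except the pair of (sorted)
indices `{p, q}` — with cosine `= 1/3` or `≤ σ < 17/81`: then `cos (t p − t q) = 17/81`. [cite: Hales2012, Lemma 7 (method)] -/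
theorem five_sorted_angles_exempt {σ : ℝ} (hσ : σ < 17 / 81) (t : Fin 5 → ℝ) (hmono : StrictMono t) (hlo : -π < t 0) (hhi : t 4 ≤ π)
    (p q : Fin 5) (hC : ∀ i j, i ≠ j → cos (t i - t j) ≤ 1 / 3 ∧
      (((i = p ∧ j = q) ∨ (i = q ∧ j = p)) ∨ cos (t i - t j) = 1 / 3 ∨ cos (t i - t j) ≤ σ)) : cos (t p - t q) = 17 / 81 := by
  have h01 : t 0 < t 1 := hmono (by decide)
  have h12 : t 1 < t 2 := hmono (by decide)
  have h23 : t 2 < t 3 := hmono (by decide)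
  have h34 : t 3 < t 4 := hmono (by decide)
  have hw : cos (2 * π - (t 4 - t 0)) = cos (t 4 - t 0) := cos_two_pi_sub _
  set g : Fin 5 → ℝ := ![t 1 - t 0, t 2 - t 1, t 3 - t 2, t 4 - t 3, 2 * π - (t 4 - t 0)] with hgdef
  have hg0 : ∀ k, 0 ≤ g k := by intro k; fin_cases k <;> simp [hgdef] <;> linarith
  have hgsum : g 0 + g 1 + g 2 + g 3 + g 4 = 2 * π := by
    simp only [hgdef, Matrix.cons_val_zero, Matrix.cons_val_one, Matrix.cons_val]; ring
  -- the cosine of gap k is the cosine of the difference of its two sorted angles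
  have hgcos : ∀ k, cos (g k) = cos (t (gapHi k) - t (gapLo k)) := by
    intro k; fin_cases k <;> simp [hgdef, gapHi, gapLo, hw]
  have hne : ∀ k, gapHi k ≠ gapLo k := by intro k; fin_cases k <;> decide
  have hgc : ∀ k, cos (g k) ≤ 1 / 3 := fun k => by rw [hgcos k]; exact (hC _ _ (hne k)).1
  -- is the exempt pair one of the five cyclic gaps?
  by_cases hex : ∃ k, (gapHi k = p ∧ gapLo k = q) ∨ (gapHi k = q ∧ gapLo k = p)
  · obtain ⟨k₀, hk₀⟩ := hex
    have hothers : ∀ k, k ≠ k₀ → cos (g k) = 1 / 3 ∨ cos (g k) ≤ σ := by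
      intro k hk
      have h := (hC _ _ (hne k)).2
      rw [hgcos k]
      rcases h with hP | h | h
      · exact absurd (gap_pair_unique p q k₀ k hk₀ hP) hk
      · exact Or.inl h
      · exact Or.inr h
    have hk := five_gaps_exempt hσ g hg0 hgsum hgc k₀ hothers
    rw [hgcos k₀] at hk
    rcases hk₀ with ⟨h1, h2⟩ | ⟨h1, h2⟩
    · rw [h1, h2] at hk; exact hk
    · rw [h1, h2, ← cos_neg, neg_sub] at hk; exact hk
  · -- otherwise every gap is constrained: contradiction with `five_gaps_false`
    exfalso
    push Not at hex
    refine Literature.Geometry.DiscreteGeometry.five_gaps_false hσ g hg0 hgsum hgc fun k => ?_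
    have h := (hC _ _ (hne k)).2
    rw [hgcos k]
    rcases h with hP | h | h
    · exact absurd hP (by rcases hex k with ⟨h1, h2⟩; tauto)
    · exact Or.inl h
    · exact Or.inr h

/-! ### Part C. Five neighbours with one exempt pair: the exempt pair is pinned -/

/-- **Five neighbours, one exempt pair ⇒ the exempt pair is at squared distance `128/27`.**  Five (injectively indexed) points of `S²(2)` at distance `2` from `v ∈ S²(2)`,
pairwise `≥ 2` apart, every pair at distance `2` or `≥ 5/2` except the pair `{u i₀, u j₀}`: then `dist (u i₀) (u j₀)² = 128/27`. [cite: Hales2012, Lemma 7 (method)] -/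
theorem five_neighbours_exempt_dist_sq {v : EuclideanSpace ℝ (Fin 3)} (hv : ‖v‖ = 2) (u : Fin 5 → EuclideanSpace ℝ (Fin 3)) (hinj : Function.Injective u)
    (hn : ∀ k, ‖u k‖ = 2) (hd : ∀ k, dist (u k) v = 2) (hpack : ∀ i j, i ≠ j → 2 ≤ dist (u i) (u j)) {i₀ j₀ : Fin 5}
    (hsep : ∀ i j, i ≠ j → dist (u i) (u j) = 2 ∨ (5 / 2 : ℝ) ≤ dist (u i) (u j) ∨ (i = i₀ ∧ j = j₀) ∨ (i = j₀ ∧ j = i₀)) :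
    dist (u i₀) (u j₀) ^ 2 = 128 / 27 := by
  obtain ⟨b, hb⟩ := exists_orthonormalBasis_third_eq hv
  set X : Fin 5 → ℝ := fun k => ⟪b 0, u k⟫ with hXdef
  set Y : Fin 5 → ℝ := fun k => ⟪b 1, u k⟫ with hYdef
  have hZ : ∀ k, ⟪b 2, u k⟫ = 1 := by
    intro k
    rw [hb, real_inner_smul_left, real_inner_comm, inner_eq_two_of_dist_eq_two (hn k) hv (hd k)]
    norm_num
  have hXY : ∀ k, X k ^ 2 + Y k ^ 2 = 3 := by
    intro k
    have h4 : ⟪u k, u k⟫ = 4 := by rw [real_inner_self_eq_norm_sq, hn k]; norm_num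
    rw [inner_eq_sum_three b, hZ k] at h4
    simp only [hXdef, hYdef]
    nlinarith [h4]
  set θ : Fin 5 → ℝ := fun k => Complex.arg ⟨X k, Y k⟩ with hθdef
  have hdist : ∀ i j, dist (u i) (u j) ^ 2 = 6 - 6 * cos (θ i - θ j) := by
    intro i j
    have hc := mul_add_mul_eq_three_mul_cos (hXY i) (hXY j)
    rw [dist_eq_norm, norm_sub_sq_real, hn i, hn j, inner_eq_sum_three b, hZ i, hZ j]
    simp only [hθdef]
    linarith [hc]
  have hθinj : Function.Injective θ := by
    intro i j hij
    apply hinj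
    obtain ⟨hXi, hYi⟩ := eq_sqrt_three_mul_cos_sin_arg (hXY i)
    obtain ⟨hXj, hYj⟩ := eq_sqrt_three_mul_cos_sin_arg (hXY j)
    have hij' : Complex.arg ⟨X i, Y i⟩ = Complex.arg ⟨X j, Y j⟩ := hij
    refine eq_of_inner_basis_eq b fun m => ?_
    fin_cases m
    · show X i = X j
      rw [hXi, hXj, hij']
    · show Y i = Y j
      rw [hYi, hYj, hij']
    · simp only [Fin.reduceFinMk, hZ]
  -- pairwise constraints in terms of angles (exempt pair allowed)
  have hC : ∀ i j, i ≠ j → cos (θ i - θ j) ≤ 1 / 3 ∧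
      (((i = i₀ ∧ j = j₀) ∨ (i = j₀ ∧ j = i₀)) ∨ cos (θ i - θ j) = 1 / 3 ∨ cos (θ i - θ j) ≤ 1 - (5 / 2 : ℝ) ^ 2 / 6) := by
    intro i j hij
    have hsq := hdist i j
    have h2 := hpack i j hij
    have h2sq : (2 : ℝ) ^ 2 ≤ dist (u i) (u j) ^ 2 := pow_le_pow_left₀ (by norm_num) h2 2
    refine ⟨by rw [hsq] at h2sq; linarith, ?_⟩
    rcases hsep i j hij with h | h | h
    · rw [h] at hsq; exact Or.inr (Or.inl (by linarith))
    · have h25 : (5 / 2 : ℝ) ^ 2 ≤ dist (u i) (u j) ^ 2 := pow_le_pow_left₀ (by norm_num) h 2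
      rw [hsq] at h25
      exact Or.inr (Or.inr (by linarith))
    · exact Or.inl h
  -- sort the five angles
  have hAcard : (Finset.univ.image θ).card = 5 := by
    rw [Finset.card_image_of_injective _ hθinj, Finset.card_univ, Fintype.card_fin]
  let e := (Finset.univ.image θ).orderEmbOfFin hAcard
  have hmem : ∀ k, ∃ i, θ i = e k := by
    intro k
    have := (Finset.univ.image θ).orderEmbOfFin_mem hAcard k
    rw [Finset.mem_image] at this
    obtain ⟨i, -, hi⟩ := this
    exact ⟨i, hi⟩
  choose π' hπ' using hmem
  -- π' is a bijection: every index is hit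
  have hsurj : ∀ i, ∃ k, π' k = i := by
    intro i
    have hi : θ i ∈ Finset.univ.image θ := Finset.mem_image_of_mem _ (Finset.mem_univ _)
    obtain ⟨k, hk⟩ : ∃ k, e k = θ i := by
      have := (Finset.univ.image θ).range_orderEmbOfFin hAcard
      have hi' : θ i ∈ Set.range e := by rw [this]; exact hi
      exact hi'
    exact ⟨k, hθinj (by rw [hπ' k, hk])⟩
  obtain ⟨p, hp⟩ := hsurj i₀
  obtain ⟨q, hq⟩ := hsurj j₀
  have hπinj : Function.Injective π' := by
    intro k l h
    apply e.injective
    rw [← hπ' k, ← hπ' l, h]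
  have key := five_sorted_angles_exempt Kissing125.one_sub_sq_five_halves_div_six_lt (fun k => e k) e.strictMono ?_ ?_ p q ?_
  · rw [hdist, ← hp, ← hq, hπ' p, hπ' q]
    show 6 - 6 * cos (e p - e q) = 128 / 27
    rw [key]; norm_num
  · show -π < e 0
    rw [← hπ' 0]; exact Complex.neg_pi_lt_arg _
  · show e 4 ≤ π
    rw [← hπ' 4]; exact Complex.arg_le_pi _
  · intro i j hij
    have hne : π' i ≠ π' j := fun h => hij (hπinj h)
    rw [← hπ' i, ← hπ' j]
    obtain ⟨h1, h2⟩ := hC (π' i) (π' j) hne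
    refine ⟨h1, ?_⟩
    rcases h2 with hP | h | h
    · left
      rcases hP with ⟨ha, hb'⟩ | ⟨ha, hb'⟩
      · exact Or.inl ⟨hπinj (ha.trans hp.symm), hπinj (hb'.trans hq.symm)⟩
      · exact Or.inr ⟨hπinj (ha.trans hq.symm), hπinj (hb'.trans hp.symm)⟩
    · exact Or.inr (Or.inl h)
    · exact Or.inr (Or.inr h)

/-! ### Part D. In a one-free-pair configuration a five-contact node pins the exempt pair -/

/-- **Five contacts pin the exempt pair.**  In a one-free-pair `5/2`-configuration with exempt points `a, b`, if some node `v` has (at least) five contacts then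
`dist a b ^ 2 = 128/27` (in particular `a ≠ b`: a degenerate exemption admits no five-contact node). [cite: Hales2012, Lemma 7 (method)] -/
theorem dist_sq_exempt_eq_of_five_contacts {S : Set (EuclideanSpace ℝ (Fin 3))} (h12 : ∀ x ∈ S, ‖x‖ = 2)
    (hpk : ∀ x ∈ S, ∀ y ∈ S, x = y ∨ 2 ≤ dist x y) {a b : EuclideanSpace ℝ (Fin 3)}
    (hdich : ∀ x ∈ S, ∀ y ∈ S, x = y ∨ dist x y = 2 ∨ (5 / 2 : ℝ) ≤ dist x y ∨ (x = a ∧ y = b) ∨ (x = b ∧ y = a))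
    {v : EuclideanSpace ℝ (Fin 3)} (hv : v ∈ S) {F : Finset (EuclideanSpace ℝ (Fin 3))} (hFS : ∀ u ∈ F, u ∈ S) (hd : ∀ u ∈ F, dist u v = 2)
    (h5 : 5 ≤ F.card) : dist a b ^ 2 = 128 / 27 := by
  classical
  -- exactly five contacts, containing a and b
  have hle5 := card_contacts_le_five_of_oneFree h12 hdich hv hFS hd
  have hcard : F.card = 5 := le_antisymm hle5 h5
  obtain ⟨haF, hbF⟩ := card_contacts_le_four_of_oneFree h12 hdich hv hFS hd h5
  set e := (F.equivFinOfCardEq hcard).symm with he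
  set u : Fin 5 → EuclideanSpace ℝ (Fin 3) := fun k => ((e k : F) : EuclideanSpace ℝ (Fin 3)) with hu
  have hinj : Function.Injective u := Subtype.val_injective.comp e.injective
  obtain ⟨i₀, hi₀⟩ : ∃ i, u i = a := ⟨e.symm ⟨a, haF⟩, by simp [hu]⟩
  obtain ⟨j₀, hj₀⟩ : ∃ j, u j = b := ⟨e.symm ⟨b, hbF⟩, by simp [hu]⟩
  have hmemF : ∀ k, u k ∈ F := fun k => (e k).2
  have key := five_neighbours_exempt_dist_sq (h12 v hv) u hinj (fun k => h12 _ (hFS _ (hmemF k))) (fun k => hd _ (hmemF k))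
    (fun i j hij => ((hpk _ (hFS _ (hmemF i)) _ (hFS _ (hmemF j))).resolve_left fun h => hij (hinj h))) (i₀ := i₀) (j₀ := j₀) ?_
  · rwa [hi₀, hj₀] at key
  · intro i j hij
    rcases hdich _ (hFS _ (hmemF i)) _ (hFS _ (hmemF j)) with h | h | h | ⟨h1, h2⟩ | ⟨h1, h2⟩
    · exact absurd (hinj h) hij
    · exact Or.inl h
    · exact Or.inr (Or.inl h)
    · exact Or.inr (Or.inr (Or.inl ⟨hinj (h1.trans hi₀.symm), hinj (h2.trans hj₀.symm)⟩))
    · exact Or.inr (Or.inr (Or.inr ⟨hinj (h1.trans hj₀.symm), hinj (h2.trans hi₀.symm)⟩))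

end TailResidue

end Summit.Ventures.Crystal3D.Theorems

end
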